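import Literature.Computability.QuantumComplexity.QAOAVersusThreshold
import HarnessLib

/-!
# The threshold algorithm beats the level-1 QAOA on triangle-free `D`-regular MaxCut for every `101 ≤ D ≤ 1000` (Hastings 2019, §3)

Topic `Literature/Computability/QuantumComplexity` (pub-qadeq lane); sequel of
`QAOAVersusThreshold.lean`, which proves Hastings' instance-by-instance comparison for `3 ≤ D ≤ 100`
(`hastings_local_beats_qaoa_one_le_hundred`; the threshold rule for `20 ≤ D ≤ 100` by 81 explicit
integer inequalities). Source [Hastings2019BoundedDepth] = M. B. Hastings, *Classical and Quantum
Bounded Depth Approximation Algorithms*, QIC 19 (2019) 1116 = arXiv:1905.07047, §3 (held tex text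
p0009 L27): “if one simply numerically optimizes the threshold … we find that for all choices of
`3 ≤ D ≤ 1000` that this threshold algorithm outperforms the QAOA with the exceptions of `D = 3,4,6,11`
for which the QAOA is better”, and §3.4 (p0011 L35): “We have only numerically tested the performance
of the threshold algorithm up to `D = 1000`”.

THIS FILE completes the printed range: for every `101 ≤ D ≤ 1000` the one-round threshold rule
`𝒜_τ` of Hirvonen–Rybicki–Schmid–Suomela with the explicit threshold `τ = ⌊(D + ⌊√D⌋)/2⌋` has, on
every triangle-free `D`-regular graph with an edge, expected cut STRICTLY larger than
`M₁ = max_{γ,β} F₁(γ,β)` (WHJR Cor. 1), as exact integer inequalities replayed in the kernel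
(0 facts, 0 sorry):

* `pascalStep` / `pascalIter` / `pascalIter_eq` — row `d = D − 1` of Pascal's triangle with a running
  prefix sum, `C(d, n+1) = C(d, n)(d − n)/(n+1)` (linear in `D`, so the whole range is two `decide`s);
* `profA_thrZ` / `profB_thrZ` — Hastings' `2^{D−1}A_q`, `2^{D−1}B_q` of the threshold profile are
  `2 Σ_{n<τ} C(d,n) − 2^d` and `2 Σ_{n<τ−1} C(d,n) − 2^d`;
* `LargeThrCheck d` (decidable) = the integer criterion of `maxLevel_one_lt_expCutCount_of_profile`
  (`b² < a²` and `4·16^d·d^d < (a² − b²)²(d+1)^{d+1}`) for that `τ`, with soundness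
  `maxLevel_one_lt_expCutCount_threshold_of_check`;
* `largeThrCheck_range₁` (`100 ≤ d ≤ 549`), `largeThrCheck_range₂` (`550 ≤ d ≤ 999`),
  `largeThrCheck_range`; **`maxLevel_one_lt_expCutCount_threshold_thousand`** (`101 ≤ D ≤ 1000`) and
  the headline **`hastings_local_beats_qaoa_one_le_thousand`**: for every `3 ≤ D ≤ 1000` some
  one-round classical local rule beats QAOA₁ on every triangle-free `D`-regular graph with an edge —
  exactly the range the paper states.

HONEST FRAMING: instance-level adjudication of specific advantage claims; no claim about BQP vs
BPP or the summit. As in the parent file: EXPECTED cut of a one-round classical rule versus the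
OPTIMUM over angles of the level-1 QAOA expectation; nothing about `p ≥ 2`, sampling, or devices.
NOT formalised: `D > 1000` (§3.4's scaling argument “it seems like it would not be difficult to give
a precise proof of this using asymptotic properties of a binomial distribution but we do not give
this”); the paper's thresholds are “numerically optimized” per `D`, ours is the fixed rule
`⌊(D + ⌊√D⌋)/2⌋`, which suffices on this range (margin ≈ 20 % in the squared criterion).
-/

noncomputable section

open Finset Literature.Combinatorics.SimpleGraph.TriangleFreeLocalCut

namespace Literature.Computability.QuantumComplexity

namespace QAOA

variable {V : Type*} [Fintype V] [DecidableEq V] (G : SimpleGraph V) [DecidableRel G.Adj]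

/-- One step along row `d` of Pascal's triangle with a running prefix sum: state `(n, C(d,n),
Σ_{k<n} C(d,k))` ↦ `(n+1, C(d,n+1), Σ_{k≤n} C(d,k))`, using `C(d,n+1) = C(d,n)(d−n)/(n+1)`.
[cite: Hastings2019BoundedDepth, §3 (“for all choices of 3 ≤ D ≤ 1000 … this threshold algorithm
outperforms the QAOA”)] -/
def pascalStep (d : ℕ) (s : ℕ × ℕ × ℕ) : ℕ × ℕ × ℕ :=
  (s.1 + 1, s.2.1 * (d - s.1) / (s.1 + 1), s.2.2 + s.2.1)

/-- `k` steps from `(0, 1, 0)`: `pascalIter d k = (k, C(d,k), Σ_{n<k} C(d,n))`. [cite: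
Hastings2019BoundedDepth, §3] -/
def pascalIter (d : ℕ) : ℕ → ℕ × ℕ × ℕ
  | 0 => (0, 1, 0)
  | k + 1 => pascalStep d (pascalIter d k)

/-- Correctness of the row iteration. [cite: Hastings2019BoundedDepth, §3] -/
theorem pascalIter_eq (d k : ℕ) :
    pascalIter d k = (k, d.choose k, ∑ n ∈ range k, d.choose n) := by
  induction k with
  | zero => simp [pascalIter]
  | succ k ih =>
      rw [pascalIter, ih, pascalStep]
      simp only
      congr 1
      congr 1
      · have h := Nat.choose_succ_right_eq d k
        rw [← h, Nat.mul_div_cancel _ (Nat.succ_pos k)]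
      · rw [sum_range_succ]

/-- The integer criterion of `QAOAVersusThreshold` for the threshold rule `𝒜_τ`,
`τ = ⌊(D + ⌊√D⌋)/2⌋`, `D = d + 1`, evaluated through `pascalIter`: with `P = Σ_{n<τ−1} C(d,n)`,
`c = C(d,τ−1)`, `a = 2(P + c) − 2^d`, `b = 2P − 2^d`, require `b² < a²` and
`4·16^d·d^d < (a² − b²)²·(d+1)^{d+1}`. [cite: Hastings2019BoundedDepth, §3] -/
def LargeThrCheck (d : ℕ) : Prop :=
  let τ := (d + 1 + Nat.sqrt (d + 1)) / 2
  let r := pascalIter d (τ - 1)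
  let a : ℤ := 2 * ((r.2.2 + r.2.1 : ℕ) : ℤ) - 2 ^ d
  let b : ℤ := 2 * (r.2.2 : ℤ) - 2 ^ d
  1 ≤ τ ∧ τ ≤ d + 1 ∧ b ^ 2 < a ^ 2 ∧
    4 * (16 : ℤ) ^ d * (d : ℤ) ^ d < (a ^ 2 - b ^ 2) ^ 2 * ((d : ℤ) + 1) ^ (d + 1)

/-- Decidability of the check (plumbing). [cite: Hastings2019BoundedDepth, §3] -/
instance : DecidablePred LargeThrCheck := fun d => by
  unfold LargeThrCheck
  infer_instance

/-- `profA` of the threshold profile: `Σ_{n<D} C(d,n)·(±1) = 2 Σ_{n<τ} C(d,n) − 2^d` (`D = d+1`,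
`τ ≤ D`). [cite: Hastings2019BoundedDepth, §3.3] -/
theorem profA_thrZ {d τ : ℕ} (hτ : τ ≤ d + 1) :
    profA (d + 1) (thrZ τ) = 2 * ∑ n ∈ range τ, (d.choose n : ℤ) - 2 ^ d := by
  unfold profA thrZ
  rw [Nat.add_sub_cancel]
  have h : ∀ n, (d.choose n : ℤ) * (if n < τ then (1 : ℤ) else -1) =
      2 * (if n < τ then (d.choose n : ℤ) else 0) - d.choose n := by
    intro n; split_ifs <;> ring
  simp_rw [h]
  rw [sum_sub_distrib, ← mul_sum, ← sum_filter]
  have hf : (range (d + 1)).filter (fun n => n < τ) = range τ := by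
    ext n; simp only [mem_filter, mem_range]; omega
  have h2 : ∑ n ∈ range (d + 1), (d.choose n : ℤ) = 2 ^ d := by
    exact_mod_cast Nat.sum_range_choose d
  rw [hf, h2]

/-- `profB` of the threshold profile: `Σ_{n<D} C(d,n)·q(n+1) = 2 Σ_{n<τ−1} C(d,n) − 2^d`
(`1 ≤ τ ≤ D`). [cite: Hastings2019BoundedDepth, §3.3] -/
theorem profB_thrZ {d τ : ℕ} (hτ1 : 1 ≤ τ) (hτ : τ ≤ d + 1) :
    profB (d + 1) (thrZ τ) = 2 * ∑ n ∈ range (τ - 1), (d.choose n : ℤ) - 2 ^ d := by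
  unfold profB thrZ
  rw [Nat.add_sub_cancel]
  have h : ∀ n, (d.choose n : ℤ) * (if n + 1 < τ then (1 : ℤ) else -1) =
      2 * (if n + 1 < τ then (d.choose n : ℤ) else 0) - d.choose n := by
    intro n; split_ifs <;> ring
  simp_rw [h]
  rw [sum_sub_distrib, ← mul_sum, ← sum_filter]
  have hf : (range (d + 1)).filter (fun n => n + 1 < τ) = range (τ - 1) := by
    ext n; simp only [mem_filter, mem_range]; omega
  have h2 : ∑ n ∈ range (d + 1), (d.choose n : ℤ) = 2 ^ d := by
    exact_mod_cast Nat.sum_range_choose d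
  rw [hf, h2]

/-- **Soundness of the check**: `LargeThrCheck d` puts the threshold rule `𝒜_τ`,
`τ = ⌊(D+⌊√D⌋)/2⌋`, strictly above QAOA₁ on every triangle-free `D = d+1`-regular graph with an
edge (via `maxLevel_one_lt_expCutCount_of_profile`). [cite: Hastings2019BoundedDepth, §3] -/
theorem maxLevel_one_lt_expCutCount_threshold_of_check {d : ℕ} (hd : 0 < d) (h : LargeThrCheck d)
    (hreg : G.IsRegularOfDegree (d + 1)) (hG : G.CliqueFree 3) (hE : G.edgeFinset.Nonempty) :
    maxLevel G 1 < expCutCount G (thresholdRule ((d + 1 + Nat.sqrt (d + 1)) / 2)) := by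
  obtain ⟨h1, h2, hb, hc⟩ := h
  generalize hT : (d + 1 + Nat.sqrt (d + 1)) / 2 = T at h1 h2 hb hc ⊢
  have hr := pascalIter_eq d (T - 1)
  have e1 : (pascalIter d (T - 1)).2.1 = d.choose (T - 1) := by rw [hr]
  have e2 : (pascalIter d (T - 1)).2.2 = ∑ n ∈ range (T - 1), d.choose n := by rw [hr]
  rw [e1, e2] at hb hc
  have hA : profA (d + 1) (thrZ T) =
      2 * ((∑ n ∈ range (T - 1), d.choose n + d.choose (T - 1) : ℕ) : ℤ) - 2 ^ d := by
    rw [profA_thrZ h2, Nat.cast_add, Nat.cast_sum, ← sum_range_succ, Nat.sub_add_cancel h1]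
  have hB : profB (d + 1) (thrZ T) = 2 * ((∑ n ∈ range (T - 1), d.choose n : ℕ) : ℤ) - 2 ^ d := by
    rw [profB_thrZ h1 h2, Nat.cast_sum]
  refine maxLevel_one_lt_expCutCount_of_profile G hd Nat.one_pos (thresholdRule_symmetric_thrZ T _)
    ?_ ?_ hreg hG hE
  · rw [hA, hB]; exact hb
  · rw [hA, hB]; simpa using hc

set_option maxHeartbeats 0 in
/-- The check for `100 ≤ d ≤ 549` (`101 ≤ D ≤ 550`), one `decide +kernel`. [cite:
Hastings2019BoundedDepth, §3 (“for all choices of 3 ≤ D ≤ 1000”)] -/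
theorem largeThrCheck_range₁ : ∀ d ∈ Finset.Icc 100 549, LargeThrCheck d := by
  decide +kernel

set_option maxHeartbeats 0 in
/-- The check for `550 ≤ d ≤ 999` (`551 ≤ D ≤ 1000`), one `decide +kernel`. [cite:
Hastings2019BoundedDepth, §3 (“for all choices of 3 ≤ D ≤ 1000”)] -/
theorem largeThrCheck_range₂ : ∀ d ∈ Finset.Icc 550 999, LargeThrCheck d := by
  decide +kernel

/-- The check on the whole range `100 ≤ d ≤ 999`. [cite: Hastings2019BoundedDepth, §3] -/
theorem largeThrCheck_range : ∀ d ∈ Finset.Icc 100 999, LargeThrCheck d := by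
  intro d hd
  rw [Finset.mem_Icc] at hd
  by_cases h : d ≤ 549
  · exact largeThrCheck_range₁ d (Finset.mem_Icc.2 ⟨hd.1, h⟩)
  · exact largeThrCheck_range₂ d (Finset.mem_Icc.2 ⟨by omega, hd.2⟩)

/-- **The threshold algorithm beats QAOA₁ on every triangle-free `D`-regular graph for every
`101 ≤ D ≤ 1000`**, with the explicit threshold `τ = ⌊(D + ⌊√D⌋)/2⌋` (“we find that for all choices
of `3 ≤ D ≤ 1000` that this threshold algorithm outperforms the QAOA with the exceptions of
`D = 3,4,6,11`” — the range `D ≤ 100` is `maxLevel_one_lt_expCutCount_threshold_large` of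
`QAOAVersusThreshold`; here the rest of the printed range, as exact integer inequalities checked in
the kernel). [cite: Hastings2019BoundedDepth, §3] -/
theorem maxLevel_one_lt_expCutCount_threshold_thousand {D : ℕ} (hD : 101 ≤ D) (hD' : D ≤ 1000)
    (hreg : G.IsRegularOfDegree D) (hG : G.CliqueFree 3) (hE : G.edgeFinset.Nonempty) :
    maxLevel G 1 < expCutCount G (thresholdRule ((D + Nat.sqrt D) / 2)) := by
  obtain ⟨d, rfl⟩ : ∃ d, D = d + 1 := ⟨D - 1, by omega⟩
  exact maxLevel_one_lt_expCutCount_threshold_of_check G (by omega)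
    (largeThrCheck_range d (Finset.mem_Icc.2 ⟨by omega, by omega⟩)) hreg hG hE

/-- **Hastings 2019, §3 on the paper's whole stated range `3 ≤ D ≤ 1000`**: some one-round
classical local rule (threshold, soft threshold at `D = 6, 11`, or the discrete tensor rule at
`D = 3, 4`) beats the level-1 QAOA on every triangle-free `D`-regular graph with an edge — the
tree's `hastings_local_beats_qaoa_one_le_hundred` (`D ≤ 100`) extended by the kernel check above.
[cite: Hastings2019BoundedDepth, §3 (“we will show that a local classical algorithm beats this QAOA
for all values of D”; “for all choices of 3 ≤ D ≤ 1000”)] -/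
theorem hastings_local_beats_qaoa_one_le_thousand {D : ℕ} (hD : 3 ≤ D) (hD' : D ≤ 1000)
    (hreg : G.IsRegularOfDegree D) (hG : G.CliqueFree 3) (hE : G.edgeFinset.Nonempty) :
    (∃ τ, maxLevel G 1 < expCutCount G (thresholdRule τ)) ∨
      maxLevel G 1 < expCutCount G softRule6 ∨ maxLevel G 1 < expCutCount G softRule11 ∨
      maxLevel G 1 < vexpCutCount G tensorW tensorF := by
  by_cases h : D ≤ 100
  · exact hastings_local_beats_qaoa_one_le_hundred G hD h hreg hG hE
  · exact Or.inl ⟨_, maxLevel_one_lt_expCutCount_threshold_thousand G (by omega) hD' hreg hG hE⟩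

end QAOA

end Literature.Computability.QuantumComplexity
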